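import Summits.MatrixMultiplication.OmegaCensus.STPPVosperPrimeTableLaw

/-!
# ω-census (abelian STPP census): tools for the SLACK-1 Vosper law at prime order — almost-progressions, holed windows, greedy tilings (kernel)

HONEST FRAMING (pub-omega census; verbatim): lottery ticket; floor = certified bounds/negative ranges.
Census STRUCTURE (seat pub-omega-stpp-1 gen 30, 2026-08-28), family (b2).  Pure `ℕ` / `ℤ/pℤ` bookkeeping used by the slack-1 law
(`STPPVosperSlackOneLaw.lean`, successor of `STPPVosperPrimeTableLaw.lean`): when the N18 chain of a block has slack ONE instead of zero, the
Hamidoune–Rødseth inverse theorem replaces Vosper's at the loose Cauchy–Davenport step and the objects of the table argument change shape —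
the complement of the blocks in the window is a progression with ONE TERM REMOVED (case α), or the window has ONE HOLE and the blocks are
translates of a run with one point removed (case β).  Nothing here is progress on `ω`.

## Contents

* §1 `apErase t j k μ = {t + i•j : i < k, i ≠ μ}` (a `k`-term progression with the term of index `μ` removed): membership, affine images,
  `eq_apErase_of_subset_apFinset` (a `k − 1`-subset of a `k`-term progression is an `apErase`), `exists_adjacent_of_apErase` (for `k ≥ 4` it
  contains two consecutive terms `x, x + j`), `apErase_last_eq_apErase_zero` (re-indexing when the last term is the removed one).
* §2 `tableAlpha p n m r J` — the case-α window table as a `Bool` checker (decided per pattern by `decide +kernel`; the window test precedes the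
  prefix-count so that only window survivors are counted), `tableAlpha_spec` (its logical meaning), and `val_mem_of_nat_table_erase_prime` — the
  table wrapper of `STPPVosperPrimeTableLaw` for an `apErase` instead of an `apFinset`.
* §3 `greedyTiles G fuel X` — the greedy test "the finite set `X ⊆ ℕ` is a disjoint union of translates of `G`" (repeatedly remove `min X + G`), its
  SOUNDNESS `greedyTiles_of_tiling` (a genuine disjoint union of translates of `G ∋ 0` passes the test), and the case-β table `tableBeta p n₁ m b J`
  (`Bool`: window `{0,…,n₁−1}` with one hole, the `m`-term progression removed, the rest must FAIL the greedy test for every `G = {0,…,b} ∖ {g₀+1}`)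
  with its meaning `tableBeta_spec`.
  (`Bool` checkers rather than `Prop` tables: nested bounded quantifiers comparing two bound naturals overflow `Decidable` instance synthesis.)
* §4 `val_image_tiles` — transport of a disjoint union of translates of `G` inside a window of `ℤ/pℤ` to `ℕ` by `ZMod.val` (no wrap-around when
  `window + b ≤ p`).

References: Y. O. Hamidoune, Ø. J. Rødseth, Acta Arith. 92 (2000) 251–262 (almost-progressions); M. B. Nathanson, GTM 165, §2.5.
-/

open Finset
open scoped Pointwise

namespace Summit.MatrixMultiplication.OmegaCensus.CubeNB

open Literature.Combinatorics.Additive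

/-! ## §1 Progressions with one term removed -/

section Erase

variable {p : ℕ} [hp : Fact p.Prime]

/-- `apErase t j k μ = {t + i•j : i < k, i ≠ μ}`: the `k`-term progression from `t` with step `j`, the term of index `μ` removed
(an "almost-progression" in the sense of Hamidoune–Rødseth when `μ < k`). [cite: HamidouneRodseth2000, §1 (definition of almost-progression)] -/
def apErase (t j : ZMod p) (k μ : ℕ) : Finset (ZMod p) := ((range k).erase μ).image fun i : ℕ => t + i • j

/-- Membership in `apErase`. [folklore] -/
theorem mem_apErase {t j : ZMod p} {k μ : ℕ} {x : ZMod p} : x ∈ apErase t j k μ ↔ ∃ i, i < k ∧ i ≠ μ ∧ t + i • j = x := by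
  simp only [apErase, Finset.mem_image, Finset.mem_erase, Finset.mem_range]
  constructor
  · rintro ⟨i, ⟨hne, hi⟩, h⟩; exact ⟨i, hi, hne, h⟩
  · rintro ⟨i, hi, hne, h⟩; exact ⟨i, ⟨hne, hi⟩, h⟩

/-- `apErase ⊆ apFinset`. [folklore] -/
theorem apErase_subset_apFinset (t j : ZMod p) (k μ : ℕ) : apErase t j k μ ⊆ apFinset t j k := by
  intro x hx
  obtain ⟨i, hi, -, rfl⟩ := mem_apErase.1 hx
  exact mem_apFinset.2 ⟨i, hi, rfl⟩

/-- Affine image of an `apErase`: `x ↦ u·x + c` maps `apErase t j k μ` to `apErase (u·t + c) (u·j) k μ`. [folklore] -/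
theorem image_affine_apErase (u c t j : ZMod p) (k μ : ℕ) :
    (apErase t j k μ).image (fun x => u * x + c) = apErase (u * t + c) (u * j) k μ := by
  rw [apErase, apErase, Finset.image_image]
  apply Finset.image_congr
  intro i _
  simp only [Function.comp_apply, nsmul_eq_mul]
  ring

/-- Cardinality of an `apErase` with `μ < k ≤ p`, `j ≠ 0`: exactly `k − 1`. [folklore] -/
theorem card_apErase {t j : ZMod p} (hj : j ≠ 0) {k μ : ℕ} (hk : k ≤ p) (hμ : μ < k) : #(apErase t j k μ) + 1 = k := by
  rw [apErase, Finset.card_image_of_injOn, Finset.card_erase_of_mem (Finset.mem_range.2 hμ), Finset.card_range]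
  · omega
  · intro i hi i' hi' h
    have him := Finset.mem_range.1 (Finset.mem_of_mem_erase (Finset.mem_coe.1 hi))
    have him' := Finset.mem_range.1 (Finset.mem_of_mem_erase (Finset.mem_coe.1 hi'))
    exact zmod_natMul_injOn hj (by omega) (by omega) h

/-- **A `(k−1)`-subset of a `k`-term progression is the progression with one term removed** (`k ≤ p`, step `≠ 0`). [folklore] -/
theorem eq_apErase_of_subset_apFinset {t j : ZMod p} (hj : j ≠ 0) {k : ℕ} (hk : k ≤ p) {S : Finset (ZMod p)}
    (hS : S ⊆ apFinset t j k) (hcard : #S + 1 = k) : ∃ μ, μ < k ∧ S = apErase t j k μ := by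
  have hcardAP : #(apFinset t j k) = k := card_apFinset hj hk
  have hdiff : #(apFinset t j k \ S) = 1 := by rw [Finset.card_sdiff_of_subset hS]; omega
  obtain ⟨y, hy⟩ := Finset.card_eq_one.1 hdiff
  have hyAP : y ∈ apFinset t j k \ S := by rw [hy]; exact Finset.mem_singleton_self y
  obtain ⟨μ, hμ, rfl⟩ := mem_apFinset.1 (Finset.mem_sdiff.1 hyAP).1
  refine ⟨μ, hμ, ?_⟩
  have hsub : S ⊆ apErase t j k μ := by
    intro x hx
    obtain ⟨i, hi, rfl⟩ := mem_apFinset.1 (hS hx)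
    refine mem_apErase.2 ⟨i, hi, ?_, rfl⟩
    rintro rfl
    exact (Finset.mem_sdiff.1 hyAP).2 hx
  apply Finset.eq_of_subset_of_card_le hsub
  have h := card_apErase (t := t) hj hk hμ
  omega

/-- For `k ≥ 4`, a `k`-term progression with one term removed still contains two CONSECUTIVE terms `x, x + j` (indices `0,1` or `2,3`). [folklore] -/
theorem exists_adjacent_of_apErase (t j : ZMod p) {k μ : ℕ} (hk : 4 ≤ k) :
    ∃ x, x ∈ apErase t j k μ ∧ x + j ∈ apErase t j k μ := by
  by_cases hμ : 2 ≤ μ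
  · refine ⟨t + 0 • j, mem_apErase.2 ⟨0, by omega, by omega, rfl⟩, mem_apErase.2 ⟨1, by omega, by omega, ?_⟩⟩
    rw [zero_nsmul, add_zero, one_nsmul]
  · refine ⟨t + 2 • j, mem_apErase.2 ⟨2, by omega, by omega, rfl⟩, mem_apErase.2 ⟨3, by omega, by omega, ?_⟩⟩
    rw [succ_nsmul, add_assoc]

/-- Re-indexing: removing the LAST term of a `(k+1)`-term progression from `t` = removing the FIRST term of the `(k+1)`-term progression from `t − j`.
[folklore] -/
theorem apErase_last_eq_apErase_zero (t j : ZMod p) (k : ℕ) : apErase t j (k + 1) k = apErase (t - j) j (k + 1) 0 := by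
  ext x
  rw [mem_apErase, mem_apErase]
  constructor
  · rintro ⟨i, hi, hne, rfl⟩
    refine ⟨i + 1, by omega, by omega, ?_⟩
    rw [succ_nsmul]; abel
  · rintro ⟨i, hi, hne, rfl⟩
    obtain ⟨i', rfl⟩ : ∃ i', i = i' + 1 := ⟨i - 1, by omega⟩
    refine ⟨i', by omega, by omega, ?_⟩
    rw [succ_nsmul]; abel

/-- `apErase` with the index `0` removed from a `(k+1)`-term progression is the `k`-term progression from `t + j`. [folklore] -/
theorem apErase_zero_eq_apFinset (t j : ZMod p) (k : ℕ) : apErase t j (k + 1) 0 = apFinset (t + j) j k := by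
  ext x
  rw [mem_apErase, mem_apFinset]
  constructor
  · rintro ⟨i, hi, hne, rfl⟩
    obtain ⟨i', rfl⟩ : ∃ i', i = i' + 1 := ⟨i - 1, by omega⟩
    exact ⟨i', by omega, by rw [succ_nsmul]; abel⟩
  · rintro ⟨i, hi, rfl⟩
    exact ⟨i + 1, by omega, by omega, by rw [succ_nsmul]; abel⟩

/-- A `k`-term progression is the `(k+1)`-term progression from `t − j` with its first term removed (so genuine progressions are covered by the
`apErase` bookkeeping). [folklore] -/
theorem apFinset_eq_apErase_zero (t j : ZMod p) (k : ℕ) : apFinset t j k = apErase (t - j) j (k + 1) 0 := by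
  rw [apErase_zero_eq_apFinset, sub_add_cancel]

end Erase

/-! ## §2 The table for an almost-progression (case α): `Bool` checker, its meaning, and the wrapper -/

section TableErase

/-- **Case-α table checker** (`Bool`, decided by `decide +kernel` per `(p, n, m, r)`).  For all `j, t < p` with `j ∉ J` and every removed index
`μ < m`: it is NOT the case that all positions `(t + j·k) mod p` (`k < m`, `k ≠ μ`) lie in `[0, n)` and satisfy the prefix law
`r ∣ pos_k − #{i < m, i ≠ μ : pos_i < pos_k}`.  The window test comes first so that the count is only evaluated for window survivors. [folklore] -/
def tableAlpha (p n m r : ℕ) (J : Finset ℕ) : Bool :=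
  (List.range p).all fun j => (List.range p).all fun t => decide (j ∈ J) || (List.range m).all fun μ =>
    !((List.range m).all fun k => decide (k = μ) || decide ((t + j * k) % p < n)) ||
    !((List.range m).all fun k => decide (k = μ) ||
        decide (r ∣ (t + j * k) % p - #(((range m).erase μ).filter fun i => (t + j * i) % p < (t + j * k) % p)))

/-- **Meaning of the case-α checker.** [folklore] -/
theorem tableAlpha_spec {p n m r : ℕ} {J : Finset ℕ} (h : tableAlpha p n m r J = true) :
    ∀ j < p, ∀ t < p, ∀ μ < m, (∀ k < m, k ≠ μ → (t + j * k) % p < n) →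
      (∀ k < m, k ≠ μ → r ∣ (t + j * k) % p - #(((range m).erase μ).filter fun i => (t + j * i) % p < (t + j * k) % p)) →
      j ∈ J := by
  intro j hj t ht μ hμ hwin hgap
  rw [tableAlpha, List.all_eq_true] at h
  have h1 := h j (List.mem_range.2 hj)
  rw [List.all_eq_true] at h1
  have h2 := h1 t (List.mem_range.2 ht)
  rw [Bool.or_eq_true, decide_eq_true_eq, List.all_eq_true] at h2
  rcases h2 with hJ | h3
  · exact hJ
  have h4 := h3 μ (List.mem_range.2 hμ)
  rw [Bool.or_eq_true, Bool.not_eq_true', Bool.not_eq_true'] at h4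
  exfalso
  rcases h4 with h5 | h5
  · rw [Bool.eq_false_iff] at h5
    apply h5
    rw [List.all_eq_true]
    intro k hk
    rw [Bool.or_eq_true, decide_eq_true_eq, decide_eq_true_eq]
    by_cases hkμ : k = μ
    · exact Or.inl hkμ
    · exact Or.inr (hwin k (List.mem_range.1 hk) hkμ)
  · rw [Bool.eq_false_iff] at h5
    apply h5
    rw [List.all_eq_true]
    intro k hk
    rw [Bool.or_eq_true, decide_eq_true_eq, decide_eq_true_eq]
    by_cases hkμ : k = μ
    · exact Or.inl hkμ
    · exact Or.inr (hgap k (List.mem_range.1 hk) hkμ)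

variable {p : ℕ} [hp : Fact p.Prime]

/-- **Table wrapper, almost-progression.**  Given the (meaning of the) case-α table for `(p, n, m, r)` with target `J`: if `S = apErase t j m μ`
(`j ≠ 0`, `μ < m ≤ p`) lies in `{0,…,n−1}` (`n ≤ p`) and `r ∣ x.val − #{y ∈ S : y.val < x.val}` at every `x ∈ S`, then `j.val ∈ J`. [folklore] -/
theorem val_mem_of_nat_table_erase_prime {n m r : ℕ} {J : Finset ℕ} (hn : n ≤ p) (hm : m ≤ p)
    (htable : ∀ j < p, ∀ t < p, ∀ μ < m, (∀ k < m, k ≠ μ → (t + j * k) % p < n) →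
      (∀ k < m, k ≠ μ → r ∣ (t + j * k) % p - #(((range m).erase μ).filter fun i => (t + j * i) % p < (t + j * k) % p)) → j ∈ J)
    {t j : ZMod p} (hj : j ≠ 0) {μ : ℕ} (hμ : μ < m) (hSV : apErase t j m μ ⊆ apFinset 0 1 n)
    (hgap : ∀ x ∈ apErase t j m μ, r ∣ x.val - #((apErase t j m μ).filter fun y => y.val < x.val)) : j.val ∈ J := by
  have hpos : ∀ i, i < m → i ≠ μ → (t.val + j.val * i) % p < n := by
    intro i hi hne
    rw [← val_add_nsmul_zmod]
    exact (mem_apFinset_zero_one_iff hn).1 (hSV (mem_apErase.2 ⟨i, hi, hne, rfl⟩))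
  have hcount : ∀ c : ℕ, #((apErase t j m μ).filter fun y => y.val < c) =
      #(((range m).erase μ).filter fun i => (t.val + j.val * i) % p < c) := by
    intro c
    rw [apErase, Finset.filter_image, Finset.card_image_of_injOn]
    · apply congrArg Finset.card
      apply Finset.filter_congr
      intro i _
      rw [val_add_nsmul_zmod]
    · intro i hi i' hi' h
      have him := Finset.mem_range.1 (Finset.mem_of_mem_erase (Finset.mem_filter.1 (Finset.mem_coe.1 hi)).1)
      have him' := Finset.mem_range.1 (Finset.mem_of_mem_erase (Finset.mem_filter.1 (Finset.mem_coe.1 hi')).1)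
      exact zmod_natMul_injOn hj (by omega) (by omega) h
  have hgap' : ∀ k, k < m → k ≠ μ → r ∣ (t.val + j.val * k) % p -
      #(((range m).erase μ).filter fun i => (t.val + j.val * i) % p < (t.val + j.val * k) % p) := by
    intro k hk hne
    have h := hgap (t + k • j) (mem_apErase.2 ⟨k, hk, hne, rfl⟩)
    rwa [hcount, val_add_nsmul_zmod] at h
  exact htable j.val (ZMod.val_lt j) t.val (ZMod.val_lt t) μ hμ hpos hgap'

end TableErase

/-! ## §3 Greedy tilings of finite sets of naturals (case β) -/

section Greedy

/-- **Greedy tiling test.**  `greedyTiles G fuel X`: repeatedly (at most `fuel` times) remove from `X` the translate `min X + G`; succeed iff every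
removed translate was inside the current set and the set is exhausted.  Decidable by construction (`Bool`). [folklore] -/
def greedyTiles (G : Finset ℕ) : ℕ → Finset ℕ → Bool
  | 0, X => decide (X = ∅)
  | fuel + 1, X =>
    if h : X.Nonempty then decide (G.image (X.min' h + ·) ⊆ X) && greedyTiles G fuel (X \ G.image (X.min' h + ·)) else true

/-- `greedyTiles` accepts the empty set. [folklore] -/
theorem greedyTiles_empty (G : Finset ℕ) (fuel : ℕ) : greedyTiles G fuel ∅ = true := by
  cases fuel with
  | zero => simp [greedyTiles]
  | succ f => simp [greedyTiles]

/-- **Soundness of the greedy tiling test.**  If `X = ⋃_{k ∈ s} (g k + G)` is a union of PAIRWISE DISJOINT translates of a finite `G ∋ 0` and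
`#s ≤ fuel`, then `greedyTiles G fuel X = true`.  (The minimum of `X` lies in some translate `g k + G`; as `g k = g k + 0 ∈ X` it is `g k` itself, so
the greedy step removes exactly that translate, and what is left is the disjoint union over `s ∖ {k}`.) [folklore] -/
theorem greedyTiles_of_tiling (G : Finset ℕ) (h0 : 0 ∈ G) {ι : Type*} [DecidableEq ι] (g : ι → ℕ) :
    ∀ (fuel : ℕ) (s : Finset ι), #s ≤ fuel → (s : Set ι).PairwiseDisjoint (fun k => G.image (g k + ·)) →
      greedyTiles G fuel (s.biUnion fun k => G.image (g k + ·)) = true := by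
  intro fuel
  induction fuel with
  | zero =>
    intro s hs _
    rw [Finset.card_eq_zero.1 (Nat.le_zero.1 hs), Finset.biUnion_empty]
    simp [greedyTiles]
  | succ f ih =>
    intro s hs hdisj
    set X := s.biUnion fun k => G.image (g k + ·) with hX
    by_cases hne : X.Nonempty
    · rw [greedyTiles, dif_pos hne, Bool.and_eq_true, decide_eq_true_eq]
      -- the minimum of X is some g k₀
      set x₀ := X.min' hne with hx₀
      have hx₀mem : x₀ ∈ X := Finset.min'_mem X hne
      obtain ⟨k₀, hk₀, hx₀k⟩ := Finset.mem_biUnion.1 hx₀mem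
      obtain ⟨c, hc, hx₀c⟩ := Finset.mem_image.1 hx₀k
      have hgk₀X : g k₀ ∈ X := Finset.mem_biUnion.2 ⟨k₀, hk₀, Finset.mem_image.2 ⟨0, h0, by simp⟩⟩
      have hle : x₀ ≤ g k₀ := Finset.min'_le X (g k₀) hgk₀X
      have hx₀eq : x₀ = g k₀ := by omega
      have htile : G.image (x₀ + ·) = G.image (g k₀ + ·) := by rw [hx₀eq]
      refine ⟨?_, ?_⟩
      · rw [htile]
        exact Finset.subset_biUnion_of_mem (fun k => G.image (g k + ·)) hk₀
      · -- what remains is the disjoint union over s.erase k₀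
        have hrest : X \ G.image (x₀ + ·) = (s.erase k₀).biUnion fun k => G.image (g k + ·) := by
          rw [htile, hX, ← Finset.insert_erase hk₀, Finset.biUnion_insert, Finset.insert_erase hk₀]
          rw [Finset.union_sdiff_left, Finset.sdiff_eq_self_iff_disjoint]
          rw [Finset.disjoint_biUnion_left]
          intro k hk
          have hkne : k ≠ k₀ := Finset.ne_of_mem_erase hk
          exact (hdisj (Finset.mem_coe.2 (Finset.mem_of_mem_erase hk)) (Finset.mem_coe.2 hk₀) hkne)
        rw [hrest]
        apply ih
        · rw [Finset.card_erase_of_mem hk₀]; omega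
        · exact hdisj.subset (Finset.coe_subset.2 (Finset.erase_subset k₀ s))
    · rw [greedyTiles, dif_neg hne]

/-- **Case-β table checker** (`Bool`).  For all `j, t < p` with `j ∉ J` whose `m` positions `(t + j·i) mod p` lie in `[0, n₁)`, every hole
`h < n₁` off the positions and every removed offset `g₀ + 1` (`g₀ < b`): the greedy tiling test of `[0,n₁) ∖ ({h} ∪ positions)` by translates of
`{0,…,b} ∖ {g₀+1}` FAILS. [folklore] -/
def tableBeta (p n₁ m b : ℕ) (J : Finset ℕ) : Bool :=
  (List.range p).all fun j => (List.range p).all fun t =>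
    decide (j ∈ J) ||
    !((List.range m).all fun i => decide ((t + j * i) % p < n₁)) ||
    (List.range n₁).all fun h =>
      decide (h ∈ (range m).image fun i => (t + j * i) % p) ||
      (List.range b).all fun g₀ =>
        !(greedyTiles ((range (b + 1)).erase (g₀ + 1)) n₁
            (((range n₁).erase h).filter fun x => x ∉ (range m).image fun i => (t + j * i) % p))

/-- **Meaning of the case-β checker.** [folklore] -/
theorem tableBeta_spec {p n₁ m b : ℕ} {J : Finset ℕ} (h : tableBeta p n₁ m b J = true) :
    ∀ j < p, ∀ t < p, (∀ i < m, (t + j * i) % p < n₁) → ∀ hh < n₁, hh ∉ (range m).image (fun i => (t + j * i) % p) →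
      ∀ g₀ < b, greedyTiles ((range (b + 1)).erase (g₀ + 1)) n₁
          (((range n₁).erase hh).filter fun x => x ∉ (range m).image fun i => (t + j * i) % p) = true → j ∈ J := by
  intro j hj t ht hwin hh hhh hhole g₀ hg₀ hgreedy
  rw [tableBeta, List.all_eq_true] at h
  have h1 := h j (List.mem_range.2 hj)
  rw [List.all_eq_true] at h1
  have h2 := h1 t (List.mem_range.2 ht)
  rw [Bool.or_eq_true, Bool.or_eq_true, decide_eq_true_eq, Bool.not_eq_true', List.all_eq_true] at h2
  rcases h2 with (hJ | h3) | h3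
  · exact hJ
  · exfalso
    rw [Bool.eq_false_iff] at h3
    apply h3
    rw [List.all_eq_true]
    intro i hi
    rw [decide_eq_true_eq]
    exact hwin i (List.mem_range.1 hi)
  · exfalso
    have h4 := h3 hh (List.mem_range.2 hhh)
    rw [Bool.or_eq_true, decide_eq_true_eq, List.all_eq_true] at h4
    rcases h4 with h5 | h5
    · exact hhole h5
    · have h6 := h5 g₀ (List.mem_range.2 hg₀)
      rw [Bool.not_eq_true', hgreedy] at h6
      exact Bool.noConfusion h6

end Greedy

/-! ## §4 From `ℤ/pℤ` to `ℕ`: translates inside a window do not wrap -/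

section Window

variable {p : ℕ} [hp : Fact p.Prime]

/-- In a window `{0,…,n−1}` of `ℤ/pℤ` with `n + b ≤ p`: if `g + i` (`i ∈ G ⊆ {0,…,b}`, `0 ∈ G`) all lie in the window, then
`(g + i).val = g.val + i` (no wrap-around). [folklore] -/
theorem val_add_nat_of_window {n b : ℕ} (hnb : n + b ≤ p) {G : Finset ℕ} (hG : G ⊆ range (b + 1)) (h0 : 0 ∈ G) {g : ZMod p}
    (hwin : ∀ i ∈ G, g + (i : ZMod p) ∈ apFinset (0 : ZMod p) 1 n) {i : ℕ} (hi : i ∈ G) : (g + (i : ZMod p)).val = g.val + i := by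
  have hn : n ≤ p := by omega
  have hg : g.val < n := by
    have h := hwin 0 h0
    rw [Nat.cast_zero, add_zero] at h
    exact (mem_apFinset_zero_one_iff hn).1 h
  have hib : i < b + 1 := Finset.mem_range.1 (hG hi)
  have hlt : g.val + i < p := by omega
  rw [ZMod.val_add, ZMod.val_natCast, Nat.mod_eq_of_lt (by omega : i < p), Nat.mod_eq_of_lt hlt]

/-- **Transport of a union of translates to `ℕ`.**  Inside the window `{0,…,n−1}` (`n + b ≤ p`), the `val`-image of the disjoint union
`⋃_{k∈s} (g k + G)` (`0 ∈ G ⊆ {0,…,b}`) is the disjoint union `⋃_{k∈s} ((g k).val + G)` of translates in `ℕ`. [folklore] -/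
theorem val_image_tiles {n b : ℕ} (hnb : n + b ≤ p) {G : Finset ℕ} (hG : G ⊆ range (b + 1)) (h0 : 0 ∈ G) {ι : Type*} (s : Finset ι)
    (g : ι → ZMod p) (hwin : ∀ k ∈ s, ∀ i ∈ G, g k + (i : ZMod p) ∈ apFinset (0 : ZMod p) 1 n)
    (hdisj : (s : Set ι).PairwiseDisjoint fun k => G.image fun i : ℕ => g k + (i : ZMod p)) :
    (s.biUnion fun k => G.image fun i : ℕ => g k + (i : ZMod p)).image ZMod.val = s.biUnion (fun k => G.image ((g k).val + ·)) ∧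
      (s : Set ι).PairwiseDisjoint fun k => G.image ((g k).val + ·) := by
  have hval : ∀ k ∈ s, ∀ i ∈ G, (g k + (i : ZMod p)).val = (g k).val + i :=
    fun k hk i hi => val_add_nat_of_window hnb hG h0 (hwin k hk) hi
  have himg : ∀ k ∈ s, (G.image fun i : ℕ => g k + (i : ZMod p)).image ZMod.val = G.image ((g k).val + ·) := by
    intro k hk
    rw [Finset.image_image]
    exact Finset.image_congr fun i hi => hval k hk i (Finset.mem_coe.1 hi)
  refine ⟨?_, ?_⟩
  · rw [Finset.biUnion_image]
    exact Finset.biUnion_congr rfl himg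
  · intro k hk k' hk' hne
    rw [Function.onFun, ← himg k (Finset.mem_coe.1 hk), ← himg k' (Finset.mem_coe.1 hk')]
    exact Finset.disjoint_image (ZMod.val_injective p) |>.2 (hdisj hk hk' hne)

end Window

end Summit.MatrixMultiplication.OmegaCensus.CubeNB
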